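import Summits.AtomisticToContinuum.BoseEinsteinCondensation.Theorems.GaussianDominationCan.Negative.CruxForms
import Literature.MathematicalPhysics.QuantumManyBody.HardCoreScatteringLength
import Literature.MathematicalPhysics.QuantumManyBody.PeriodicBoseGasUpperBoundProofs

/-!
# Crux `FibreConductance` — hard cores self-vacuate the crux

Crux disprover file for `stmt-AtomisticToContinuum-9480` (route `BECThomsonPrinciple`).  The route
says the crux is "false verbatim for hard cores, which are excluded" by the boundedness hypothesis
`∃ B, v ≤ B`.  In fact the crux's own hypotheses exclude them: for `v = hardCorePotential 1`
(admissible, unbounded) a zero-free state (H2) has `periodicEnergy v Φ = ⊤` (`N ≥ 2`,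
`periodicEnergy_hardCore_eq_top`: the Born weight is positive on the overlap region), so (H1) ∧ (H2)
force `E₀ = ⊤` (`hardCore_hypotheses_unsatisfiable`), which fails in the whole LSSY dilute regime by
Dyson's upper bound (the PROVED fact `LSSY2005_upperBound_periodic_holds` with `a = 1`,
`hardCore_no_admissible_state`).  So the crux is VACUOUSLY TRUE at hard cores: dropping boundedness
cannot be refuted there; boundedness is not the load-bearing hypothesis — (H1) is (see
`NearMinimiserFalse.lean`).  All [folklore].
-/

noncomputable section

namespace Summit.AtomisticToContinuum.BoseEinsteinCondensation.Theorems.FibreConductance.Negative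

open MeasureTheory Literature.MathematicalPhysics.QuantumManyBody.BoseGas
open scoped ENNReal NNReal

/-! ### Hard cores self-vacuate the crux (boundedness of `v` is NOT the load-bearing hypothesis) -/

section HardCore

open Summit.AtomisticToContinuum.BoseEinsteinCondensation.Theorems.GaussianDominationCan.Negative

variable {m : ℕ} {L : ℝ}

/-- Inside the small cube `[0,s)^{3N}`, `s ≤ 1/2`, particles `0` and `1` overlap: `‖x₀ - x₁‖ < 1`.
[folklore] -/
theorem norm_sub_lt_one_of_mem_cellN {s : ℝ} (hs : s ≤ 1 / 2) {X : Config (m + 2)}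
    (hX : X ∈ cellN (m + 2) s) : ‖X 0 - X 1‖ < 1 := by
  have hk : ∀ k : Fin 3, ‖(X 0 - X 1) k‖ ^ 2 ≤ (1 / 2) ^ 2 := by
    intro k
    have h0 := (hX 0) k
    have h1 := (hX 1) k
    rw [Set.mem_Ico] at h0 h1
    rw [PiLp.sub_apply, Real.norm_eq_abs, sq_abs]
    have : |X 0 k - X 1 k| ≤ 1 / 2 := by rw [abs_le]; constructor <;> linarith
    nlinarith [abs_nonneg (X 0 k - X 1 k), sq_abs (X 0 k - X 1 k)]
  have hsq : ‖X 0 - X 1‖ ^ 2 ≤ 3 / 4 := by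
    rw [EuclideanSpace.norm_eq, Real.sq_sqrt (Finset.sum_nonneg fun k _ => by positivity),
      Fin.sum_univ_three]
    linarith [hk 0, hk 1, hk 2]
  nlinarith [norm_nonneg (X 0 - X 1)]

/-- Overlapping hard cores have infinite interaction: `‖x₀ - x₁‖ < 1 ⇒ Σ_{i<j} v^per(xᵢ-xⱼ) = ⊤`.
[folklore] -/
theorem periodicInteraction_hardCore_eq_top {X : Config (m + 2)} (h : ‖X 0 - X 1‖ < 1) :
    periodicInteraction (hardCorePotential 1) L X = ⊤ := by
  unfold periodicInteraction
  refine eq_top_iff.2 ?_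
  have h01 : periodizedPotential (hardCorePotential 1) L (X 0 - X 1) = ⊤ := by
    refine eq_top_iff.2 ((le_of_eq ?_).trans (le_periodizedPotential _ L _))
    exact (hardCorePotential_of_lt h).symm
  calc (⊤ : ℝ≥0∞) = periodizedPotential (hardCorePotential 1) L (X 0 - X 1) := h01.symm
    _ ≤ ∑ j ∈ Finset.univ.filter (fun j : Fin (m + 2) => (0 : Fin (m + 2)) < j),
          periodizedPotential (hardCorePotential 1) L (X 0 - X j) :=
        Finset.single_le_sum (f := fun j => periodizedPotential (hardCorePotential 1) L (X 0 - X j))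
          (fun j _ => zero_le) (Finset.mem_filter.2 ⟨Finset.mem_univ _, Fin.zero_lt_one⟩)
    _ ≤ ∑ i : Fin (m + 2), ∑ j ∈ Finset.univ.filter (fun j : Fin (m + 2) => i < j),
          periodizedPotential (hardCorePotential 1) L (X i - X j) :=
        Finset.single_le_sum (f := fun i : Fin (m + 2) => ∑ j ∈ Finset.univ.filter (fun j => i < j),
          periodizedPotential (hardCorePotential 1) L (X i - X j)) (fun i _ => zero_le) (Finset.mem_univ 0)

/-- **A zero-free state has infinite hard-core energy** (`N ≥ 2`): the Born weight is positive on
the overlap region, where the interaction is `⊤`. So for hard cores the crux's hypotheses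
(H1) `periodicEnergy v Φ = E₀` and (H2) `Φ ≠ 0 everywhere` force `E₀ = ⊤`. [folklore] -/
theorem periodicEnergy_hardCore_eq_top (hL : 0 < L) (Φ : PeriodicTrialState (m + 2) L)
    (hz : ∀ X, Φ.ψ X ≠ 0) : periodicEnergy (hardCorePotential 1) Φ = ⊤ := by
  set s : ℝ := min L (1 / 2) with hsdef
  have hs0 : 0 < s := lt_min hL (by norm_num)
  have hsL : s ≤ L := min_le_left _ _
  have hs2 : s ≤ 1 / 2 := min_le_right _ _
  have hsub : cellN (m + 2) s ⊆ cellN (m + 2) L := fun X hX i k =>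
    ⟨((hX i) k).1, ((hX i) k).2.trans_le hsL⟩
  have hvol : volume (cellN (m + 2) s) ≠ 0 := by
    rw [volume_cellN]; exact pow_ne_zero _ (pow_ne_zero _ (by rwa [ne_eq, ENNReal.ofReal_eq_zero, not_le]))
  unfold periodicEnergy
  refine eq_top_iff.2 ?_
  calc (⊤ : ℝ≥0∞) = ⊤ * volume (cellN (m + 2) s) := (ENNReal.top_mul hvol).symm
    _ = ∫⁻ _X in cellN (m + 2) s, ⊤ := (setLIntegral_const _ _).symm
    _ ≤ ∫⁻ X in cellN (m + 2) s, kineticDensity Φ.ψ X +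
          periodicInteraction (hardCorePotential 1) L X * ((‖Φ.ψ X‖₊ : ℝ≥0∞) ^ 2) := by
        refine setLIntegral_mono' (measurableSet_cellN _ _) fun X hX => ?_
        rw [periodicInteraction_hardCore_eq_top (norm_sub_lt_one_of_mem_cellN hs2 hX), ENNReal.top_mul]
        · exact le_add_self
        · exact pow_ne_zero _ (by simpa using hz X)
    _ ≤ ∫⁻ X in cellN (m + 2) L, kineticDensity Φ.ψ X +
          periodicInteraction (hardCorePotential 1) L X * ((‖Φ.ψ X‖₊ : ℝ≥0∞) ^ 2) :=
        lintegral_mono_set hsub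

/-- **The crux is vacuous at hard cores whenever `E₀ < ⊤`**: no `Φ` satisfies (H1) ∧ (H2). [folklore] -/
theorem hardCore_hypotheses_unsatisfiable (hL : 0 < L)
    (hE : periodicGroundStateEnergy (hardCorePotential 1) (m + 2) L ≠ ⊤) (Φ : PeriodicTrialState (m + 2) L) :
    ¬ (periodicEnergy (hardCorePotential 1) Φ = periodicGroundStateEnergy (hardCorePotential 1) (m + 2) L ∧
        ∀ X, Φ.ψ X ≠ 0) := fun ⟨h1, h2⟩ =>
  hE (h1 ▸ periodicEnergy_hardCore_eq_top hL Φ h2)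

/-- **… which is the whole LSSY dilute regime**: by Dyson's upper bound (the PROVED Literature theorem
`LSSY2005_upperBound_periodic_holds`, with `a = 1` from `scatteringLength_hardCorePotential`) there is
`c > 0` such that `E₀^per(N, L) < ⊤` for all `N ≥ 2`, `L > 2` with `a/b ≤ c`
(`b = (4πρ₁/3)^{-1/3}`, `ρ₁ = (N-1)/L³`); there the hard-core crux has NO admissible `Φ`.  Hence
dropping the boundedness hypothesis `∃ B, v ≤ B` cannot be refuted at hard cores (the statement is
vacuously true there): boundedness is not the load-bearing hypothesis, (H1) is. [folklore] -/
theorem hardCore_no_admissible_state :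
    ∃ c : ℝ, 0 < c ∧ ∀ (m : ℕ) (L : ℝ), 0 < L → 2 < L →
      1 / (4 * Real.pi * ((((m + 2 : ℕ) : ℝ) - 1) / L ^ 3) / 3) ^ (-(1 : ℝ) / 3) ≤ c →
        ∀ Φ : PeriodicTrialState (m + 2) L,
          ¬ (periodicEnergy (hardCorePotential 1) Φ =
              periodicGroundStateEnergy (hardCorePotential 1) (m + 2) L ∧ ∀ X, Φ.ψ X ≠ 0) := by
  have hfr : ∀ r, (1 : ℝ) < r → hardCorePotential 1 r = 0 := fun r hr => hardCorePotential_of_le hr.le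
  have ha : scatteringLength (hardCorePotential 1) ≠ ⊤ := by
    rw [scatteringLength_hardCorePotential]; exact ENNReal.ofReal_ne_top
  obtain ⟨C, c, hC, hc, hmain⟩ :=
    LSSY2005_upperBound_periodic_holds (hardCorePotential 1) 1 (measurable_hardCorePotential 1) hfr ha
  refine ⟨c, hc, fun m L hL hL2 hab Φ => hardCore_hypotheses_unsatisfiable hL ?_ Φ⟩
  have h := hmain (m + 2) L (by omega) hL (by linarith)
  simp only [toReal_scatteringLength_hardCorePotential zero_le_one] at h
  exact ne_top_of_le_ne_top ENNReal.ofReal_ne_top (h hab)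

end HardCore

end Summit.AtomisticToContinuum.BoseEinsteinCondensation.Theorems.FibreConductance.Negative

end
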